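import Summits.QuantumFields.YangMills.Theorems.SwapVirialDeficitQuantitativeLaplaceFibredChart
import HarnessLib

/-!
# The quantitative Morse–Bott Laplace method from FIBREWISE TAYLOR BOUNDS: the odd/even front end
# (free-hands support of ⟨stmt-QuantumFields-24197⟩ `SwapVirialDeficit.SwapGluedStiffness`; generic, sequel of
# ✓`SwapVirialDeficitQuantitativeLaplaceFibred` ∕ ✓`…FibredChart`)

The fibred core ✓`laplaceMethod_quantitative_fibred[_chart]` takes its window data DECOMPOSED — `f = ½⟪A p y,y⟫ + c + r`,
`w = w₀(p)(1 + ℓ + e)` with `c, ℓ` odd in `y` and ALL FOUR JOINTLY MEASURABLE on `M × V`.  A consumer naturally has, fibre by fibre, only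
TAYLOR BOUNDS along rays (e.g. from ✓`abs_sub_taylor_three_le` on each fibre): an odd cubic form `τ_p` with `|τ_p(y)| ≤ B₃‖y‖³` and
`|f̃(p,y) − ½⟪A p y,y⟫ − τ_p(y)| ≤ B₄‖y‖⁴`, and for the amplitude an odd linear form `λ_p` with `|λ_p(y)| ≤ N₁‖y‖`,
`|w̃(p,y) − w₀(p)(1 + λ_p(y))| ≤ N₂·w₀(p)‖y‖²` — where the joint measurability of `p ↦ D³f̃_p(0)` would be a genuine nuisance.  This file removes
the nuisance: the decomposition is taken to be the ODD ∕ EVEN PARTS in `y`,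
`c(p,y) = (f̃(p,y) − f̃(p,−y))/2`, `r(p,y) = (f̃(p,y) + f̃(p,−y))/2 − ½⟪A p y,y⟫`, `ℓ = (w̃(p,y) − w̃(p,−y))/(2w₀(p))`,
`e = (w̃(p,y) + w̃(p,−y) − 2w₀(p))/(2w₀(p))`, which are jointly measurable as soon as `f̃`, `w̃`, `w₀`, `⟪A p y,y⟫` are, are odd ∕ reproduce
`f̃`, `w̃` by pure algebra, and inherit the bounds `|c| ≤ (B₃ + B₄R)‖y‖³`, `|r| ≤ B₄‖y‖⁴`, `|ℓ| ≤ (N₁ + N₂R)‖y‖`, `|e| ≤ N₂‖y‖²` from the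
EXISTENTIAL per-fibre Taylor data (§1).  Hence:
* ★★★ `laplaceMethod_quantitative_fibred_of_taylor` (product coordinates) and ★★★ `laplaceMethod_quantitative_fibred_chart_of_taylor`
  (through a fibred chart with the off-tube tail): the conclusions of the fibred core with `A₃ = B₃ + B₄R`, `A₄ = B₄`, `D = N₁ + N₂R`, `G = N₂`,
  under the smallness `(B₃ + B₄R)R + B₄R² ≤ λ/(8(m+8))`, `(N₁ + N₂R)R ≤ 1`, `N₂R² ≤ 1`, from per-fibre EXISTENTIAL Taylor data only.

HONEST FRAMING: elementary real analysis (odd/even parts) around proved cores; width 0 by itself toward any lattice statement; ⟨24197⟩,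
⟨24196⟩, ⟨24194⟩, ⟨24497⟩ and every rung ∕ summit statement stay OPEN; own crux ⟨22884⟩ OPEN (blocked-on ⟨19935⟩); the Yang–Mills mass gap is
NOT proved; no summit is proved by a line.  Width seat ym-line-sfw-p2-w2 g58 (cell ym-idea-1, free hands), `--supports stmt-QuantumFields-24197`.
THEOREMS ONLY (0 `def`, 0 `sorry`), standard axioms.

## References
* K. W. Breitung, *Asymptotic Approximations for Probability Integrals*, LNM 1592 (1994), Lemma 7 p. 12 (Taylor forms), Thm 41 p. 56. [Breitung1994]
* R. Wong, *Asymptotic Approximations of Integrals*, SIAM Classics 34 (2001), §IX.5 (odd terms integrate to zero). [Wong2001AsymptoticApproximationsIntegrals]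
-/

set_option autoImplicit false

noncomputable section

open _root_.MeasureTheory _root_.Filter _root_.Set _root_.Module _root_.Metric
open scoped _root_.Topology _root_.Real _root_.InnerProductSpace

namespace Summit.QuantumFields.YangMills.Theorems.QuantitativeLaplace

open Literature.Analysis.Asymptotics

variable {V : Type*} [NormedAddCommGroup V] [InnerProductSpace ℝ V] [FiniteDimensional ℝ V]
  [MeasurableSpace V] [BorelSpace V]

/-! ## §1 Odd ∕ even parts inherit the Taylor bounds -/

omit [InnerProductSpace ℝ V] [FiniteDimensional ℝ V] [MeasurableSpace V] [BorelSpace V] in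
/-- ★ **Odd/even split of the phase.**  If `q` is even, `τ` odd with `|τ(y)| ≤ B₃‖y‖³` and `|F(y) − q(y) − τ(y)| ≤ B₄‖y‖⁴` on `‖y‖ ≤ R`
(`B₄ ≥ 0`), then on the ball the odd part of `F` is cubic-small and the even part is `q` up to a quartic:
`|(F(y) − F(−y))/2| ≤ (B₃ + B₄R)‖y‖³`, `|(F(y) + F(−y))/2 − q(y)| ≤ B₄‖y‖⁴`. [cite: Breitung1994, Lemma 7 p. 12] -/
theorem abs_oddEven_phase_le {F q τ : V → ℝ} (hq : ∀ y, q (-y) = q y) (hτ : ∀ y, τ (-y) = -τ y)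
    {R B₃ B₄ : ℝ} (hB₄ : 0 ≤ B₄)
    (hτb : ∀ y : V, ‖y‖ ≤ R → |τ y| ≤ B₃ * ‖y‖ ^ 3) (hrem : ∀ y : V, ‖y‖ ≤ R → |F y - q y - τ y| ≤ B₄ * ‖y‖ ^ 4)
    (y : V) (hy : ‖y‖ ≤ R) :
    |(F y - F (-y)) / 2| ≤ (B₃ + B₄ * R) * ‖y‖ ^ 3 ∧ |(F y + F (-y)) / 2 - q y| ≤ B₄ * ‖y‖ ^ 4 := by
  have hy' : ‖-y‖ ≤ R := by rwa [norm_neg]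
  have h1 := hrem y hy
  have h2 := hrem (-y) hy'
  rw [hq, hτ, norm_neg] at h2
  have h3 := hτb y hy
  have hy0 : 0 ≤ ‖y‖ := norm_nonneg y
  have h4 : ‖y‖ ^ 4 ≤ R * ‖y‖ ^ 3 := by
    have : ‖y‖ ^ 4 = ‖y‖ * ‖y‖ ^ 3 := by ring
    rw [this]
    exact mul_le_mul_of_nonneg_right hy (by positivity)
  rw [abs_le] at h1 h2 h3
  constructor
  · rw [abs_le]
    constructor <;> nlinarith
  · rw [abs_le]
    constructor <;> nlinarith

omit [InnerProductSpace ℝ V] [FiniteDimensional ℝ V] [MeasurableSpace V] [BorelSpace V] in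
/-- ★ **Odd/even split of the amplitude.**  If `λ` is odd with `|λ(y)| ≤ N₁‖y‖` and `|W(y) − w₀(1 + λ(y))| ≤ N₂·w₀·‖y‖²` on `‖y‖ ≤ R`
(`w₀, N₂ ≥ 0`), then with `ℓ = (W(y) − W(−y))/(2w₀)`, `e = (W(y) + W(−y) − 2w₀)/(2w₀)` (both `0` if `w₀ = 0`):
`W(y) = w₀(1 + ℓ + e)`, `|ℓ| ≤ (N₁ + N₂R)‖y‖`, `|e| ≤ N₂‖y‖²`. [cite: Breitung1994, Lemma 7 p. 12] -/
theorem abs_oddEven_weight_le [NormedSpace ℝ V] {W lam : V → ℝ} {w₀ : ℝ} (hw₀ : 0 ≤ w₀) (hlam : ∀ y, lam (-y) = -lam y)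
    {R N₁ N₂ : ℝ} (hN₂ : 0 ≤ N₂)
    (hlamb : ∀ y : V, ‖y‖ ≤ R → |lam y| ≤ N₁ * ‖y‖) (hrem : ∀ y : V, ‖y‖ ≤ R → |W y - w₀ * (1 + lam y)| ≤ N₂ * w₀ * ‖y‖ ^ 2)
    (y : V) (hy : ‖y‖ ≤ R) :
    W y = w₀ * (1 + (W y - W (-y)) / (2 * w₀) + (W y + W (-y) - 2 * w₀) / (2 * w₀)) ∧
    |(W y - W (-y)) / (2 * w₀)| ≤ (N₁ + N₂ * R) * ‖y‖ ∧ |(W y + W (-y) - 2 * w₀) / (2 * w₀)| ≤ N₂ * ‖y‖ ^ 2 := by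
  have hy' : ‖-y‖ ≤ R := by rwa [norm_neg]
  have h1 := hrem y hy
  have h2 := hrem (-y) hy'
  rw [hlam, norm_neg] at h2
  have h3 := hlamb y hy
  have hy0 : 0 ≤ ‖y‖ := norm_nonneg y
  rcases hw₀.eq_or_lt with h0 | hpos
  · -- `w₀ = 0`: then `W = 0` on the ball and `ℓ = e = 0`
    rw [← h0] at h1 ⊢
    simp only [zero_mul, mul_zero, sub_zero, abs_le] at h1
    have hW : W y = 0 := by linarith [h1.1, h1.2]
    have hR0 : 0 ≤ R := hy0.trans hy
    refine ⟨by simp [hW], ?_, ?_⟩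
    · simp only [mul_zero, div_zero, abs_zero]
      nlinarith [abs_nonneg (lam y), h3, mul_nonneg (mul_nonneg hN₂ hR0) hy0]
    · simp only [mul_zero, div_zero, abs_zero]
      positivity
  · have h2w : 0 < 2 * w₀ := by linarith
    refine ⟨by field_simp; ring, ?_, ?_⟩
    · rw [abs_div, abs_of_pos h2w, div_le_iff₀ h2w]
      rw [abs_le] at h1 h2 h3 ⊢
      have h4 : ‖y‖ ^ 2 ≤ R * ‖y‖ := by
        rw [sq]; exact mul_le_mul_of_nonneg_right hy hy0
      have h5 : 0 ≤ N₂ * w₀ := mul_nonneg hN₂ hw₀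
      constructor <;> nlinarith [mul_le_mul_of_nonneg_left h4 h5]
    · rw [abs_div, abs_of_pos h2w, div_le_iff₀ h2w]
      rw [abs_le] at h1 h2 ⊢
      constructor <;> nlinarith

/-! ## §2 The fibred theorem from existential per-fibre Taylor data (product coordinates) -/

section Product

variable {M : Type*} [MeasurableSpace M] {ν : Measure M} [SFinite ν]

/-- ★★★ **Quantitative Morse–Bott Laplace method from fibrewise Taylor bounds.**  `(M,ν)` s-finite base, `V` the `m`-dimensional
transversal, `A p` symmetric uniformly `λ`-coercive and jointly measurable; `f̃, w̃ : M × V → ℝ` jointly measurable, `0 ≤ w₀ ∈ L¹(ν)` measurable;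
on every fibre EXISTENTIAL Taylor data on the ball `‖y‖ ≤ R`: an odd `τ` with `|τ(y)| ≤ B₃‖y‖³`, `|f̃(p,y) − ½⟪A p y,y⟫ − τ(y)| ≤ B₄‖y‖⁴`, and an odd `λ`
with `|λ(y)| ≤ N₁‖y‖`, `|w̃(p,y) − w₀(p)(1 + λ(y))| ≤ N₂w₀(p)‖y‖²`; smallness `(B₃ + B₄R)R + B₄R² ≤ λ/(8(m+8))`, `(N₁ + N₂R)R ≤ 1`, `N₂R² ≤ 1`.
THEN for every `β > 0` the conclusion of ✓`laplaceMethod_quantitative_fibred` holds with `A₃ = B₃ + B₄R`, `A₄ = B₄`, `D = N₁ + N₂R`, `G = N₂`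
(decomposition = odd/even parts in `y`). [cite: Breitung1994, Thm 41 p. 56; Lemma 7 p. 12] [cite: Wong2001AsymptoticApproximationsIntegrals, §IX.5] -/
theorem laplaceMethod_quantitative_fibred_of_taylor {A : M → V →ₗ[ℝ] V} (hA : ∀ p, (A p).IsSymmetric) {lam : ℝ} (hlam : 0 < lam)
    (hcoer : ∀ p (y : V), lam * ‖y‖ ^ 2 ≤ ⟪A p y, y⟫_ℝ)
    (hAm : Measurable fun z : M × V => ⟪A z.1 z.2, z.2⟫_ℝ)
    {R B₃ B₄ N₁ N₂ β : ℝ} (hR : 0 < R) (hB₃ : 0 ≤ B₃) (hB₄ : 0 ≤ B₄) (hN₁ : 0 ≤ N₁) (hN₂ : 0 ≤ N₂) (hβ : 0 < β)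
    (hsmall : (B₃ + B₄ * R) * R + B₄ * R ^ 2 ≤ lam / (8 * ((finrank ℝ V : ℝ) + 8)))
    (hDR : (N₁ + N₂ * R) * R ≤ 1) (hGR : N₂ * R ^ 2 ≤ 1)
    {f w : M × V → ℝ} {w₀ : M → ℝ} (hfm : Measurable f) (hwm : Measurable w)
    (hw₀m : Measurable w₀) (hw₀ : ∀ p, 0 ≤ w₀ p) (hw₀i : Integrable w₀ ν)
    (hfT : ∀ p, ∃ τ : V → ℝ, (∀ y, τ (-y) = -τ y) ∧ (∀ y : V, ‖y‖ ≤ R → |τ y| ≤ B₃ * ‖y‖ ^ 3) ∧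
      ∀ y : V, ‖y‖ ≤ R → |f (p, y) - (1 / 2) * ⟪A p y, y⟫_ℝ - τ y| ≤ B₄ * ‖y‖ ^ 4)
    (hwT : ∀ p, ∃ lam' : V → ℝ, (∀ y, lam' (-y) = -lam' y) ∧ (∀ y : V, ‖y‖ ≤ R → |lam' y| ≤ N₁ * ‖y‖) ∧
      ∀ y : V, ‖y‖ ≤ R → |w (p, y) - w₀ p * (1 + lam' y)| ≤ N₂ * w₀ p * ‖y‖ ^ 2) :
    IntegrableOn (fun z : M × V => Real.exp (-(β * f z)) * w z) (univ ×ˢ closedBall (0 : V) R) (ν.prod volume) ∧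
    Integrable (fun p => w₀ p / Real.sqrt (LinearMap.det (A p))) ν ∧
    |(∫ z in univ ×ˢ closedBall (0 : V) R, Real.exp (-(β * f z)) * w z ∂(ν.prod volume)) -
        (2 * π / β) ^ ((finrank ℝ V : ℝ) / 2) * ∫ p, w₀ p / Real.sqrt (LinearMap.det (A p)) ∂ν| ≤
      (16 * ((finrank ℝ V : ℝ) + 8) / (lam * R ^ 2) + 16 * N₂ * ((finrank ℝ V : ℝ) + 8) / lam
        + 256 * (B₄ + ((B₃ + B₄ * R) + B₄ * R) * ((N₁ + N₂ * R) + N₂ * R)) * ((finrank ℝ V : ℝ) + 8) ^ 2 / lam ^ 2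
        + 18432 * ((B₃ + B₄ * R) + B₄ * R) ^ 2 * ((finrank ℝ V : ℝ) + 8) ^ 3 / lam ^ 3) / β *
        ((2 * π / β) ^ ((finrank ℝ V : ℝ) / 2) * ∫ p, w₀ p / Real.sqrt (LinearMap.det (A p)) ∂ν) := by
  -- the odd/even decomposition, jointly measurable
  have hneg : Measurable fun z : M × V => ((z.1, -z.2) : M × V) := measurable_fst.prodMk measurable_snd.neg
  set c : M × V → ℝ := fun z => (f z - f (z.1, -z.2)) / 2 with hcdef
  set r : M × V → ℝ := fun z => (f z + f (z.1, -z.2)) / 2 - (1 / 2) * ⟪A z.1 z.2, z.2⟫_ℝ with hrdef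
  set ℓ : M × V → ℝ := fun z => (w z - w (z.1, -z.2)) / (2 * w₀ z.1) with hℓdef
  set e : M × V → ℝ := fun z => (w z + w (z.1, -z.2) - 2 * w₀ z.1) / (2 * w₀ z.1) with hedef
  have hc_meas : Measurable c := (hfm.sub (hfm.comp hneg)).div_const 2
  have hr_meas : Measurable r := ((hfm.add (hfm.comp hneg)).div_const 2).sub (hAm.const_mul _)
  have hℓ_meas : Measurable ℓ := (hwm.sub (hwm.comp hneg)).div ((hw₀m.comp measurable_fst).const_mul 2)
  have he_meas : Measurable e :=
    ((hwm.add (hwm.comp hneg)).sub ((hw₀m.comp measurable_fst).const_mul 2)).div ((hw₀m.comp measurable_fst).const_mul 2)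
  have hc_odd : ∀ p (y : V), c (p, -y) = -c (p, y) := fun p y => by
    simp only [hcdef, neg_neg]; ring
  have hℓ_odd : ∀ p (y : V), ℓ (p, -y) = -ℓ (p, y) := fun p y => by
    simp only [hℓdef, neg_neg]; ring
  have hq : ∀ p (y : V), ⟪A p (-y), -y⟫_ℝ = ⟪A p y, y⟫_ℝ := fun p y => by rw [map_neg, inner_neg_neg]
  -- the bounds from the existential Taylor data
  have hcb : ∀ p (y : V), ‖y‖ ≤ R → |c (p, y)| ≤ (B₃ + B₄ * R) * ‖y‖ ^ 3 := fun p y hy => by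
    obtain ⟨τ, hτo, hτb, hrem⟩ := hfT p
    exact (abs_oddEven_phase_le (F := fun y => f (p, y)) (q := fun y => (1 / 2) * ⟪A p y, y⟫_ℝ) (τ := τ)
      (fun y => by simp only [hq]) hτo hB₄ hτb hrem y hy).1
  have hrb : ∀ p (y : V), ‖y‖ ≤ R → |r (p, y)| ≤ B₄ * ‖y‖ ^ 4 := fun p y hy => by
    obtain ⟨τ, hτo, hτb, hrem⟩ := hfT p
    exact (abs_oddEven_phase_le (F := fun y => f (p, y)) (q := fun y => (1 / 2) * ⟪A p y, y⟫_ℝ) (τ := τ)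
      (fun y => by simp only [hq]) hτo hB₄ hτb hrem y hy).2
  have hwsplit : ∀ p (y : V), ‖y‖ ≤ R → w (p, y) = w₀ p * (1 + ℓ (p, y) + e (p, y)) ∧
      |ℓ (p, y)| ≤ (N₁ + N₂ * R) * ‖y‖ ∧ |e (p, y)| ≤ N₂ * ‖y‖ ^ 2 := fun p y hy => by
    obtain ⟨lam', hlo, hlb, hrem⟩ := hwT p
    exact abs_oddEven_weight_le (W := fun y => w (p, y)) (lam := lam') (hw₀ p) hlo hN₂ hlb hrem y hy
  have hf : ∀ p (y : V), ‖y‖ ≤ R → f (p, y) = (1 / 2) * ⟪A p y, y⟫_ℝ + c (p, y) + r (p, y) := fun p y _ => by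
    simp only [hcdef, hrdef]; ring
  exact laplaceMethod_quantitative_fibred hA hlam hcoer hAm hR (by positivity) hB₄ (by positivity) hN₂ hβ hsmall hDR hGR hfm hwm
    hc_meas hr_meas hℓ_meas he_meas hw₀m hw₀ hw₀i hc_odd hℓ_odd hcb hrb (fun p y hy => (hwsplit p y hy).2.1)
    (fun p y hy => (hwsplit p y hy).2.2) hf (fun p y hy => (hwsplit p y hy).1)

end Product

/-! ## §3 Through a fibred chart, from existential per-fibre Taylor data -/

section Chart

variable {X : Type*} [MeasurableSpace X] {μ : Measure X} [IsFiniteMeasure μ]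
variable {M : Type*} [MeasurableSpace M] {ν : Measure M} [SFinite ν]

/-- ★★★ **Quantitative Morse–Bott Laplace method through a fibred chart, from fibrewise Taylor bounds.**  The hypotheses of
✓`laplaceMethod_quantitative_fibred_chart` with the decomposed window data replaced by EXISTENTIAL per-fibre Taylor data for
`f̃(p,y) = f(Ψ(p,y)) − f₀` and `w̃(p,y) = J(p,y)·φ(Ψ(p,y))` as in `laplaceMethod_quantitative_fibred_of_taylor`; conclusion: integrability
and `|∫_X e^{−β(f−f₀)}φ dμ − 𝔐(β)| ≤ (K/β)·𝔐(β) + Φ₀·μ(X)·e^{−βη₀}` with `A₃ = B₃ + B₄R`, `A₄ = B₄`, `D = N₁ + N₂R`, `G = N₂` in `K`.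
[cite: Breitung1994, Thm 41 p. 56 with §2.3 Definitions 4–5; Lemma 7 p. 12] -/
theorem laplaceMethod_quantitative_fibred_chart_of_taylor {Ψ : M × V → X} {J : M × V → ℝ} {f φ : X → ℝ} {f₀ : ℝ}
    {A : M → V →ₗ[ℝ] V} (hA : ∀ p, (A p).IsSymmetric) {lam : ℝ} (hlam : 0 < lam)
    (hcoer : ∀ p (y : V), lam * ‖y‖ ^ 2 ≤ ⟪A p y, y⟫_ℝ)
    (hAm : Measurable fun z : M × V => ⟪A z.1 z.2, z.2⟫_ℝ)
    {R B₃ B₄ N₁ N₂ β η₀ Φ₀ : ℝ} (hR : 0 < R) (hB₃ : 0 ≤ B₃) (hB₄ : 0 ≤ B₄) (hN₁ : 0 ≤ N₁) (hN₂ : 0 ≤ N₂) (hβ : 0 < β)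
    (hsmall : (B₃ + B₄ * R) * R + B₄ * R ^ 2 ≤ lam / (8 * ((finrank ℝ V : ℝ) + 8)))
    (hDR : (N₁ + N₂ * R) * R ≤ 1) (hGR : N₂ * R ^ 2 ≤ 1)
    (hΨ : Measurable Ψ) (hΨT : MeasurableSet (Ψ '' (univ ×ˢ closedBall (0 : V) R)))
    (hJm : Measurable J) (hJ0 : ∀ z ∈ (univ : Set M) ×ˢ closedBall (0 : V) R, 0 ≤ J z)
    (hchart : μ.restrict (Ψ '' (univ ×ˢ closedBall (0 : V) R)) =
      (((ν.prod volume).restrict (univ ×ˢ closedBall (0 : V) R)).withDensity fun z => ENNReal.ofReal (J z)).map Ψ)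
    (hfm : Measurable f) (hφm : Measurable φ) {w₀ : M → ℝ}
    (hw₀m : Measurable w₀) (hw₀ : ∀ p, 0 ≤ w₀ p) (hw₀i : Integrable w₀ ν)
    (hfT : ∀ p, ∃ τ : V → ℝ, (∀ y, τ (-y) = -τ y) ∧ (∀ y : V, ‖y‖ ≤ R → |τ y| ≤ B₃ * ‖y‖ ^ 3) ∧
      ∀ y : V, ‖y‖ ≤ R → |f (Ψ (p, y)) - f₀ - (1 / 2) * ⟪A p y, y⟫_ℝ - τ y| ≤ B₄ * ‖y‖ ^ 4)
    (hwT : ∀ p, ∃ lam' : V → ℝ, (∀ y, lam' (-y) = -lam' y) ∧ (∀ y : V, ‖y‖ ≤ R → |lam' y| ≤ N₁ * ‖y‖) ∧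
      ∀ y : V, ‖y‖ ≤ R → |J (p, y) * φ (Ψ (p, y)) - w₀ p * (1 + lam' y)| ≤ N₂ * w₀ p * ‖y‖ ^ 2)
    (hout : ∀ x, x ∉ Ψ '' (univ ×ˢ closedBall (0 : V) R) → f₀ + η₀ ≤ f x)
    (hΦ₀nn : 0 ≤ Φ₀) (hΦ₀ : ∀ x, x ∉ Ψ '' (univ ×ˢ closedBall (0 : V) R) → |φ x| ≤ Φ₀) :
    Integrable (fun x => Real.exp (-(β * (f x - f₀))) * φ x) μ ∧
    |(∫ x, Real.exp (-(β * (f x - f₀))) * φ x ∂μ) -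
        (2 * π / β) ^ ((finrank ℝ V : ℝ) / 2) * ∫ p, w₀ p / Real.sqrt (LinearMap.det (A p)) ∂ν| ≤
      (16 * ((finrank ℝ V : ℝ) + 8) / (lam * R ^ 2) + 16 * N₂ * ((finrank ℝ V : ℝ) + 8) / lam
        + 256 * (B₄ + ((B₃ + B₄ * R) + B₄ * R) * ((N₁ + N₂ * R) + N₂ * R)) * ((finrank ℝ V : ℝ) + 8) ^ 2 / lam ^ 2
        + 18432 * ((B₃ + B₄ * R) + B₄ * R) ^ 2 * ((finrank ℝ V : ℝ) + 8) ^ 3 / lam ^ 3) / β *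
        ((2 * π / β) ^ ((finrank ℝ V : ℝ) / 2) * ∫ p, w₀ p / Real.sqrt (LinearMap.det (A p)) ∂ν) +
      Φ₀ * μ.real univ * Real.exp (-(β * η₀)) := by
  -- the pulled-back phase and amplitude and their odd/even parts
  set ft : M × V → ℝ := fun z => f (Ψ z) - f₀ with hft
  set wt : M × V → ℝ := fun z => J z * φ (Ψ z) with hwt
  have hftm : Measurable ft := (hfm.comp hΨ).sub measurable_const
  have hwtm : Measurable wt := hJm.mul (hφm.comp hΨ)
  have hneg : Measurable fun z : M × V => ((z.1, -z.2) : M × V) := measurable_fst.prodMk measurable_snd.neg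
  set c : M × V → ℝ := fun z => (ft z - ft (z.1, -z.2)) / 2 with hcdef
  set r : M × V → ℝ := fun z => (ft z + ft (z.1, -z.2)) / 2 - (1 / 2) * ⟪A z.1 z.2, z.2⟫_ℝ with hrdef
  set ℓ : M × V → ℝ := fun z => (wt z - wt (z.1, -z.2)) / (2 * w₀ z.1) with hℓdef
  set e : M × V → ℝ := fun z => (wt z + wt (z.1, -z.2) - 2 * w₀ z.1) / (2 * w₀ z.1) with hedef
  have hc_meas : Measurable c := (hftm.sub (hftm.comp hneg)).div_const 2
  have hr_meas : Measurable r := ((hftm.add (hftm.comp hneg)).div_const 2).sub (hAm.const_mul _)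
  have hℓ_meas : Measurable ℓ := (hwtm.sub (hwtm.comp hneg)).div ((hw₀m.comp measurable_fst).const_mul 2)
  have he_meas : Measurable e :=
    ((hwtm.add (hwtm.comp hneg)).sub ((hw₀m.comp measurable_fst).const_mul 2)).div ((hw₀m.comp measurable_fst).const_mul 2)
  have hc_odd : ∀ p (y : V), c (p, -y) = -c (p, y) := fun p y => by
    simp only [hcdef, neg_neg]; ring
  have hℓ_odd : ∀ p (y : V), ℓ (p, -y) = -ℓ (p, y) := fun p y => by
    simp only [hℓdef, neg_neg]; ring
  have hq : ∀ p (y : V), ⟪A p (-y), -y⟫_ℝ = ⟪A p y, y⟫_ℝ := fun p y => by rw [map_neg, inner_neg_neg]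
  have hcb : ∀ p (y : V), ‖y‖ ≤ R → |c (p, y)| ≤ (B₃ + B₄ * R) * ‖y‖ ^ 3 := fun p y hy => by
    obtain ⟨τ, hτo, hτb, hrem⟩ := hfT p
    exact (abs_oddEven_phase_le (F := fun y => ft (p, y)) (q := fun y => (1 / 2) * ⟪A p y, y⟫_ℝ) (τ := τ)
      (fun y => by simp only [hq]) hτo hB₄ hτb (fun y hy => by simpa only [hft] using hrem y hy) y hy).1
  have hrb : ∀ p (y : V), ‖y‖ ≤ R → |r (p, y)| ≤ B₄ * ‖y‖ ^ 4 := fun p y hy => by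
    obtain ⟨τ, hτo, hτb, hrem⟩ := hfT p
    exact (abs_oddEven_phase_le (F := fun y => ft (p, y)) (q := fun y => (1 / 2) * ⟪A p y, y⟫_ℝ) (τ := τ)
      (fun y => by simp only [hq]) hτo hB₄ hτb (fun y hy => by simpa only [hft] using hrem y hy) y hy).2
  have hwsplit : ∀ p (y : V), ‖y‖ ≤ R → wt (p, y) = w₀ p * (1 + ℓ (p, y) + e (p, y)) ∧
      |ℓ (p, y)| ≤ (N₁ + N₂ * R) * ‖y‖ ∧ |e (p, y)| ≤ N₂ * ‖y‖ ^ 2 := fun p y hy => by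
    obtain ⟨lam', hlo, hlb, hrem⟩ := hwT p
    exact abs_oddEven_weight_le (W := fun y => wt (p, y)) (lam := lam') (hw₀ p) hlo hN₂ hlb
      (fun y hy => by simpa only [hwt] using hrem y hy) y hy
  have hf : ∀ p (y : V), ‖y‖ ≤ R → f (Ψ (p, y)) - f₀ = (1 / 2) * ⟪A p y, y⟫_ℝ + c (p, y) + r (p, y) := fun p y _ => by
    simp only [hcdef, hrdef, hft]; ring
  have hw : ∀ p (y : V), ‖y‖ ≤ R → J (p, y) * φ (Ψ (p, y)) = w₀ p * (1 + ℓ (p, y) + e (p, y)) := fun p y hy => by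
    have h := (hwsplit p y hy).1
    simpa only [hwt] using h
  exact laplaceMethod_quantitative_fibred_chart hA hlam hcoer hAm hR (by positivity) hB₄ (by positivity) hN₂ hβ hsmall hDR hGR hΨ hΨT
    hJm hJ0 hchart hfm hφm hc_meas hr_meas hℓ_meas he_meas hw₀m hw₀ hw₀i hc_odd hℓ_odd hcb hrb
    (fun p y hy => (hwsplit p y hy).2.1) (fun p y hy => (hwsplit p y hy).2.2) hf hw hout hΦ₀nn hΦ₀

end Chart

end Summit.QuantumFields.YangMills.Theorems.QuantitativeLaplace

end
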